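import Summits.KontsevichZagierPeriods.KontsevichZagierPeriods.Theses.FurushoPentagon
import Literature.NumberTheory.Transcendental.KZRulesAssociator
import Literature.NumberTheory.Transcendental.KZKernelConjectureForms
import Literature.NumberTheory.Transcendental.AssociatorsRegularisation

/-!
# `StuffleInKZ` (route `FurushoPentagon`, stmt-KontsevichZagierPeriods-3931): negative-side core —
# the `∀ Z` device collapses, eval-tightness, summit-necessity, degenerate instances

Negative-side support for the crux `StuffleInKZ` (cdisprove unit, refuter
`refuter-cdisprove-stmt-KontsevichZagierPeriods-3931-g2-0`, 2026-08-15; running commentary in the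
work file `Cruxes/StuffleInKZ/Disproof.lean`). The crux asserts that for admissible indices
`s`, `t` the stuffle defect `[Δ_s]·[Δ_t] − Σ_{u ∈ s∗t} [Δ_u]` of Kontsevich's simplex
representations (`KZ.mzvRep`) lies in `KZ.relations`, for every assignment `Z` pinned to the
simplex classes on admissible indices. Nothing here refutes it. This file records, as theorems
the other seats of the crux can import:

* §1 the stuffle defect `defect Z s t`, the canonical assignment `Zcan`, and the collapse of the
  `∀ Z` device: the crux is the family of identities `⟦ζ(s)⟧⟦ζ(t)⟧ = Σ_{u∈s∗t} ⟦ζ(u)⟧` among the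
  classes `KZ.mzvClass` in the formal period ring `P = FormalRep ⧸ relations`
  (`stuffleInKZ_iff_classIdentity`), equivalently its own instance at `Zcan`
  (`stuffleInKZ_iff_canonical`);
* §2 eval-tightness (`eval_defect = 0`: Hoffman's theorem `multipleZeta_mul` + Kontsevich's
  formula `KZ.mzvRep_value_holds`) and summit-necessity (`stuffleInKZ_of_kernel`,
  `stuffleInKZ_of_summit`): a refutation of the crux would be a disproof of Conjecture 1;
* §3 the degenerate instances `s = []` / `t = []` (unit law of `P`, PROVED), the symmetry
  `(s,t) ↔ (t,s)`, the reduction to nonempty indices, and the first genuine instance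
  `s = t = [2]`: `⟦ζ(2)⟧² = 2⟦ζ(2,2)⟧ + ⟦ζ(4)⟧`.

Companion files in this directory: `LoadBearing.lean` (each hypothesis is necessary; refuted
strengthenings via the augmentation), `AdditivityOnly.lean` (the additivity-only sub-calculus
cannot prove the crux: localised evaluation), `NewtonLeibnizFree.lean` (graded evaluation; rule (3)
is independent of rules (1), (2)).

Sources: M. Hoffman, *The algebra of multiple harmonic series*, J. Algebra 194 (1997), §2 and
Thm. 4.2; M. Kontsevich, D. Zagier, *Periods* (2001), §§1.1–1.2, 4.1.
-/

noncomputable section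

namespace Summit.KontsevichZagierPeriods.Theorems.StuffleInKZ.Negative

open MeasureTheory Set
open Literature.NumberTheory.Transcendental
open Literature.NumberTheory.Transcendental.KZ
open Literature.NumberTheory.Transcendental.MZV (IsAdmissible stuffle weight isAdmissible_nil
  isAdmissible_of_mem_stuffle stuffle_cons_cons stuffle_nil_left stuffle_nil_right sum_of_mem_stuffle)
open Summit.KontsevichZagierPeriods.KontsevichZagierPeriods.Theses.FurushoPentagon (StuffleInKZ)

variable {n m : ℕ}

/-! ## §1 The `∀ Z` device collapses; the crux as an identity in `P` -/

/-- The canonical simplex class `[mzvRep u]` of an admissible index `u` (Kontsevich's iterated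
integral over `1 > t₁ > ⋯ > t_w > 0`), the only values of `Z` the crux reads.
(Kontsevich–Zagier 2001, §1.1) [folklore] -/
abbrev simplexOf (u : List ℕ) (hu : IsAdmissible u) : FormalRep :=
  of (mzvRep u hu (mzvIntegrand_isSemialgebraicFunOn_holds u) (mzvIntegrand_integrableOn_holds u hu))

open Classical in
/-- The canonical assignment: simplex class on admissible indices, `0` elsewhere. [folklore] -/
def Zcan (u : List ℕ) : FormalRep := if hu : IsAdmissible u then simplexOf u hu else 0

/-- `Zcan` is pinned: it agrees with the simplex classes on admissible indices. [folklore] -/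
theorem Zcan_of_isAdmissible (u : List ℕ) (hu : IsAdmissible u) : Zcan u = simplexOf u hu :=
  dif_pos hu

/-- `Zcan` vanishes off the admissible indices. [folklore] -/
theorem Zcan_of_not {u : List ℕ} (hu : ¬ IsAdmissible u) : Zcan u = 0 := dif_neg hu

/-- The stuffle defect `Z s · Z t − Σ_{u ∈ s ∗ t} Z u` of an assignment `Z` (Hoffman 1997, §2:
harmonic product `∗`, with multiplicity, `MZV.stuffle`). [folklore] -/
def defect (Z : List ℕ → FormalRep) (s t : List ℕ) : FormalRep :=
  Z s * Z t - ((stuffle s t).map Z).sum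

/-- The crux, unfolded through `defect` (definitional). [folklore] -/
theorem stuffleInKZ_iff_forall_pinned :
    StuffleInKZ ↔ ∀ Z : List ℕ → FormalRep, (∀ (u : List ℕ) (hu : IsAdmissible u),
      Z u = simplexOf u hu) → ∀ s t, IsAdmissible s → IsAdmissible t →
      defect Z s t ∈ relations :=
  Iff.rfl

/-- The class of the defect of a pinned assignment is the class defect
`⟦ζ(s)⟧⟦ζ(t)⟧ − Σ ⟦ζ(u)⟧` in `P`. [folklore] -/
theorem toFormalPeriod_defect {Z : List ℕ → FormalRep}
    (hZ : ∀ (u : List ℕ) (hu : IsAdmissible u), Z u = simplexOf u hu) {s t : List ℕ}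
    (hs : IsAdmissible s) (ht : IsAdmissible t) :
    toFormalPeriod (defect Z s t) = mzvClass s * mzvClass t - ((stuffle s t).map mzvClass).sum := by
  rw [defect, map_sub, map_mul, map_list_sum, List.map_map, toFormalPeriod_eq_mzvClass hZ hs,
    toFormalPeriod_eq_mzvClass hZ ht]
  congr 2
  apply List.map_congr_left
  intro u hu
  exact toFormalPeriod_eq_mzvClass hZ (isAdmissible_of_mem_stuffle hs ht hu)

/-- Membership of the defect in `relations` is the class identity in `P`. [folklore] -/
theorem defect_mem_relations_iff {Z : List ℕ → FormalRep}
    (hZ : ∀ (u : List ℕ) (hu : IsAdmissible u), Z u = simplexOf u hu) {s t : List ℕ}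
    (hs : IsAdmissible s) (ht : IsAdmissible t) :
    defect Z s t ∈ relations ↔ mzvClass s * mzvClass t = ((stuffle s t).map mzvClass).sum := by
  rw [← toFormalPeriod_eq_zero_iff, toFormalPeriod_defect hZ hs ht, sub_eq_zero]

/-- **The crux is the family of class identities** `⟦ζ(s)⟧⟦ζ(t)⟧ = Σ_{u∈s∗t} ⟦ζ(u)⟧` in the formal
period ring `P`. [folklore] -/
theorem stuffleInKZ_iff_classIdentity :
    StuffleInKZ ↔ ∀ s t, IsAdmissible s → IsAdmissible t →
      mzvClass s * mzvClass t = ((stuffle s t).map mzvClass).sum := by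
  constructor
  · intro h s t hs ht
    exact (defect_mem_relations_iff Zcan_of_isAdmissible hs ht).mp
      (h Zcan Zcan_of_isAdmissible s t hs ht)
  · intro h Z hZ s t hs ht
    exact (defect_mem_relations_iff hZ hs ht).mpr (h s t hs ht)

/-- **The `∀ Z` device collapses**: the crux is its own instance at the canonical assignment.
[folklore] -/
theorem stuffleInKZ_iff_canonical :
    StuffleInKZ ↔ ∀ s t, IsAdmissible s → IsAdmissible t → defect Zcan s t ∈ relations := by
  rw [stuffleInKZ_iff_classIdentity]
  refine forall₄_congr fun s t hs ht => ?_
  exact (defect_mem_relations_iff Zcan_of_isAdmissible hs ht).symm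

/-! ## §2 Eval-tightness and summit-necessity -/

/-- **The real shadow of the crux is a theorem**: `evalP` kills the class defect
(Hoffman 1997, Thm. 4.2 = `multipleZeta_mul`; Kontsevich's formula `KZ.evalP_mzvClass`).
[folklore] -/
theorem evalP_classDefect {s t : List ℕ} (hs : IsAdmissible s) (ht : IsAdmissible t) :
    evalP (mzvClass s * mzvClass t - ((stuffle s t).map mzvClass).sum) = 0 := by
  rw [map_sub, map_mul, map_list_sum, List.map_map, evalP_mzvClass hs, evalP_mzvClass ht,
    multipleZeta_mul hs ht, sub_eq_zero]
  congr 1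
  apply List.map_congr_left
  intro u hu
  exact (evalP_mzvClass (isAdmissible_of_mem_stuffle hs ht hu)).symm

/-- The defect of a pinned assignment evaluates to `0`. [folklore] -/
theorem eval_defect {Z : List ℕ → FormalRep}
    (hZ : ∀ (u : List ℕ) (hu : IsAdmissible u), Z u = simplexOf u hu) {s t : List ℕ}
    (hs : IsAdmissible s) (ht : IsAdmissible t) : eval (defect Z s t) = 0 := by
  have h := evalP_classDefect hs ht
  rwa [← toFormalPeriod_defect hZ hs ht, evalP_toFormalPeriod] at h

/-- **Kernel form ⇒ crux.** [folklore] -/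
theorem stuffleInKZ_of_kernel (hker : ∀ c : FormalRep, eval c = 0 → c ∈ relations) :
    StuffleInKZ :=
  fun _ hZ _ _ hs ht => hker _ (eval_defect hZ hs ht)

/-- **Summit ⇒ crux**: the crux is summit-necessary (`kzKernelConjecture_iff_isRational`).
[folklore] -/
theorem stuffleInKZ_of_summit (h : _root_.KontsevichZagierPeriods) : StuffleInKZ :=
  stuffleInKZ_of_kernel (kzKernelConjecture_iff_isRational.mpr h)

/-- Contrapositive: a refutation of the crux is a disproof of Conjecture 1. [folklore] -/
theorem not_summit_of_not_stuffleInKZ (h : ¬ StuffleInKZ) : ¬ _root_.KontsevichZagierPeriods :=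
  mt stuffleInKZ_of_summit h

/-- `eval [pt, 1] = 1`. [folklore] -/
theorem eval_of_unit : eval (of IntegralRep.unit) = 1 := by
  rw [eval_of, IntegralRep.value_unit]

/-- `[pt, 1]` is not a relation (soundness of the calculus). [folklore] -/
theorem of_unit_not_mem_relations : of IntegralRep.unit ∉ relations := fun h => by
  have h0 : eval (of IntegralRep.unit) = 0 := relations_le_ker_eval_holds h
  rw [eval_of_unit] at h0
  exact one_ne_zero h0

/-! ## §3 Degenerate instances, symmetry, the first genuine instance -/

/-- **`s = []` is the left unit law of `P`** (`KZ.mzvRep_nil`, `KZ.of_unit_mul_sub_mem_relations`).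
[folklore] -/
theorem defect_nil_left_mem {Z : List ℕ → FormalRep}
    (hZ : ∀ (u : List ℕ) (hu : IsAdmissible u), Z u = simplexOf u hu) (t : List ℕ) :
    defect Z [] t ∈ relations := by
  simp only [defect, stuffle_nil_left, List.map_cons, List.map_nil, List.sum_cons, List.sum_nil,
    add_zero]
  rw [hZ [] isAdmissible_nil, simplexOf, mzvRep_nil]
  exact of_unit_mul_sub_mem_relations (Z t)

/-- **`t = []` is the right unit law of `P`.** [folklore] -/
theorem defect_nil_right_mem {Z : List ℕ → FormalRep}
    (hZ : ∀ (u : List ℕ) (hu : IsAdmissible u), Z u = simplexOf u hu) (s : List ℕ) :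
    defect Z s [] ∈ relations := by
  simp only [defect, stuffle_nil_right, List.map_cons, List.map_nil, List.sum_cons, List.sum_nil,
    add_zero]
  rw [hZ [] isAdmissible_nil, simplexOf, mzvRep_nil]
  exact mul_of_unit_sub_mem_relations (Z s)

/-- **Symmetry**: `defect Z s t ≡ defect Z t s` modulo relations (commutativity of the Fubini
product modulo relations, `KZ.mul_sub_mul_comm_mem_relations`, and of the stuffle as a multiset,
`MZV.sum_map_stuffle_comm`). [folklore] -/
theorem defect_sub_defect_swap_mem (Z : List ℕ → FormalRep) (s t : List ℕ) :
    defect Z s t - defect Z t s ∈ relations := by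
  have h : defect Z s t - defect Z t s = Z s * Z t - Z t * Z s := by
    simp only [defect, MZV.sum_map_stuffle_comm Z s t]
    abel
  rw [h]
  exact mul_sub_mul_comm_mem_relations _ _

/-- Hence the instances `(s, t)` and `(t, s)` of the crux are equivalent. [folklore] -/
theorem defect_mem_iff_swap (Z : List ℕ → FormalRep) (s t : List ℕ) :
    defect Z s t ∈ relations ↔ defect Z t s ∈ relations := by
  constructor <;> intro h
  · simpa using relations.sub_mem h (defect_sub_defect_swap_mem Z s t)
  · simpa using relations.sub_mem h (defect_sub_defect_swap_mem Z t s)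

/-- **Reduction to nonempty indices**: the crux is equivalent to its instances with `s, t ≠ []`.
[folklore] -/
theorem stuffleInKZ_iff_ne_nil :
    StuffleInKZ ↔ ∀ Z : List ℕ → FormalRep, (∀ (u : List ℕ) (hu : IsAdmissible u),
      Z u = simplexOf u hu) → ∀ s t, s ≠ [] → t ≠ [] → IsAdmissible s → IsAdmissible t →
      defect Z s t ∈ relations := by
  constructor
  · exact fun h Z hZ s t _ _ hs ht => h Z hZ s t hs ht
  · intro h Z hZ s t hs ht
    rcases eq_or_ne s [] with rfl | hs'
    · exact defect_nil_left_mem hZ t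
    rcases eq_or_ne t [] with rfl | ht'
    · exact defect_nil_right_mem hZ s
    exact h Z hZ s t hs' ht' hs ht

/-- **First genuine instance** `s = t = [2]`: the class identity reads
`⟦ζ(2)⟧² = 2⟦ζ(2,2)⟧ + ⟦ζ(4)⟧` in `P` (its weight-4 companion with `ShuffleIsDissection` is
Grothendieck's item `ζ(4) = 4ζ(3,1)`). [folklore] -/
theorem classIdentity_two_two_iff :
    mzvClass [2] * mzvClass [2] = ((stuffle [2] [2]).map mzvClass).sum ↔
      mzvClass [2] * mzvClass [2] = 2 * mzvClass [2, 2] + mzvClass [4] := by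
  simp only [stuffle_cons_cons, stuffle_nil_left, stuffle_nil_right, List.map_cons,
    List.map_nil, List.sum_cons, List.sum_nil, List.nil_append, List.cons_append]
  constructor <;> intro h <;> rw [h] <;> ring

/-- The stuffle list is never empty. [folklore] -/
theorem stuffle_ne_nil : ∀ s t : List ℕ, stuffle s t ≠ [] := by
  intro s t
  induction s, t using MZV.stuffle.induct with
  | case1 t => simp
  | case2 a s => simp
  | case3 a s b t ih1 _ _ => simp [stuffle_cons_cons, ih1]

/-- For nonempty indices the stuffle has at least three terms (Hoffman's rule (A3)). [folklore] -/
theorem three_le_length_stuffle {s t : List ℕ} (hs : s ≠ []) (ht : t ≠ []) :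
    3 ≤ (stuffle s t).length := by
  obtain ⟨a, s, rfl⟩ := List.exists_cons_of_ne_nil hs
  obtain ⟨b, t, rfl⟩ := List.exists_cons_of_ne_nil ht
  simp only [stuffle_cons_cons, List.length_append, List.length_map]
  have h1 := List.length_pos_of_ne_nil (stuffle_ne_nil s (b :: t))
  have h2 := List.length_pos_of_ne_nil (stuffle_ne_nil (a :: s) t)
  have h3 := List.length_pos_of_ne_nil (stuffle_ne_nil s t)
  omega

end Summit.KontsevichZagierPeriods.Theorems.StuffleInKZ.Negative
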